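import Summits.SmoothPoincare4.SmoothPoincare4.Theorems.SullivanDualWitnessChargeSubstubFar
import Summits.SmoothPoincare4.SmoothPoincare4.Theorems.SullivanDualWitnessChargeHelperFlatZalcman
import Summits.SmoothPoincare4.SmoothPoincare4.Theorems.SullivanDualWitnessChargeHelperSubseqLocUnif
import Literature.Geometry.Symplectic.JHolomorphicWeierstrass
import Literature.Geometry.Symplectic.JHolomorphicReparametrisation
import Mathlib.Topology.UniformSpace.CompactConvergence

/-!
# The rescaling branch (P5)(B) of the pencil dichotomy on `Σ ∖ p`, given the local lemma

Crux `WitnessCharge` (item stmt-SmoothPoincare4-7824, route route-SmoothPoincare4-SullivanDual),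
line `Sketch`, stub `helper_rescaleAway_of` (card `Cruxes/WitnessCharge/Lines/Sketch.md`, (P5)(B)).

Gradient blow-up of entire `J`-curves `u n : ℂ → Σ ∖ p` on the unit disc, with
`u n {‖z‖ ≤ 2} ⊆ K` for a fixed compact `K ⊆ Σ ∖ p`, measured through a Whitney embedding
`ι : Σ → ℝᴺ`, produces a non-constant entire `J`-curve with image in `K`, hence one avoiding a
punctured chart ball at `p` (`CurveAway S p J`).  The argument is the classical Zalcman–Brody
rescaling (L. Zalcman 1975; R. Brody 1978; for `J`-curves Kruglikov–Overholt 1999), assembled from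
three tree lemmas and one hypothesis:

* `helper_flatZalcman` (flat Zalcman–Brody rescaling in `ℝᴺ`): recentre at a blow-up point and
  rescale `f k = ι ∘ u (n k) (c k + ·)` to `g k = f k (ξ₀ k + ρ k ·)` with `‖dg k(0)‖ = 1`,
  `‖dg k‖ ≤ 2` and `g k ∈ ι(K)` on discs of radii `M k / 2 → ∞`; on the manifold side
  `g k = ι ∘ hh k` with `hh k = u (n k) ∘ (ζ ↦ ρ k ζ + (c k + ξ₀ k))` again an entire `J`-curve
  (`IsEntireJCurve.comp_affine`);
* `helper_subseqLocUnif` (Arzelà–Ascoli with moving discs): a subsequence `g (φ j)` converges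
  locally uniformly on `ℂ` to some `v : ℂ → ℝᴺ`;
* the lift: `v` takes values in the compact `ι(K)`, so `v = ι ∘ G` with `G : ℂ → Σ ∖ p`, `G ∈ K`,
  continuous because `ι` is a closed embedding of the compact `Σ`;
* the LOCAL LEMMA (hypothesis `hLocal`, the neighbouring stub `helper_rescaleLocal`): regularity,
  `J`-holomorphy and non-degeneracy of such a limit, which makes `G` a `C^∞` `J`-holomorphic map
  with `d(e ∘ G)(0) ≠ 0`, hence non-constant;
* `exists_ball_disjoint_of_isCompact`: the compact `K` misses a punctured chart ball at `p`.
-/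

noncomputable section

set_option linter.dupNamespace false

open scoped Manifold ContDiff Topology
open Set Filter Literature.Geometry.Kaehler Literature.Geometry.Symplectic
  Literature.Topology.FourManifolds

namespace Summit.SmoothPoincare4.SmoothPoincare4.Theorems.WitnessCharge.PencilIncompleteness

/-- A `C^∞` map `v : ℂ → Σ ∖ p` read through a `C^∞` map `ι : Σ → ℝᴺ` is a `C^∞` map
`ℂ → ℝᴺ` in the flat sense (`ContDiff`). -/
theorem contDiff_embed_comp {S : HomotopySphere 4} {p : S.carrier} {N : ℕ}
    {ι : S.carrier → EuclideanSpace ℝ (Fin N)}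
    (hι : ContMDiff (𝓡 4) 𝓘(ℝ, EuclideanSpace ℝ (Fin N)) ∞ ι)
    {v : ℂ → punctured p} (hv : ContMDiff 𝓘(ℝ, ℂ) (𝓡 4) ∞ v) :
    ContDiff ℝ ∞ (fun ζ : ℂ => ι (v ζ).1) :=
  contMDiff_iff_contDiff.1 (hι.comp ((ContMDiff.subtypeVal_comp_iff (punctured p) v).2 hv))

/-- **The rescaling branch (P5)(B), given the local lemma.** If the gradients of entire
`J`-curves `u n : ℂ → Σ ∖ p` (measured through a `C^∞` injective `ι : Σ → ℝᴺ`) are unbounded on the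
unit disc while `u n {‖z‖ ≤ 2}` stays in a fixed compact `K`, then — granted the local regularity
lemma for locally uniform limits of entire `J`-curves (hypothesis) — there is a non-constant entire
`J`-curve avoiding a punctured chart ball at `p` (Zalcman–Brody rescaling, Arzelà–Ascoli, lift to
`K`). -/
theorem helper_rescaleAway_of :
    (JHolomorphicWeierstrassR4 →
    ∀ (S : HomotopySphere 4) (p : S.carrier)
      (J : ∀ x : punctured p, TangentSpace (𝓡 4) x →L[ℝ] TangentSpace (𝓡 4) x),
      (∀ (x : punctured p) (v : TangentSpace (𝓡 4) x), J x (J x v) = -v) →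
      (∀ x₀ : punctured p, ContMDiffAt (𝓡 4) 𝓘(ℝ, EuclideanSpace ℝ (Fin 4) →L[ℝ] EuclideanSpace ℝ (Fin 4)) ∞
        (inTangentCoordinates (𝓡 4) (𝓡 4) (id : punctured p → punctured p) id (fun x => J x) x₀) x₀) →
      ∀ (N : ℕ) (ι : S.carrier → EuclideanSpace ℝ (Fin N)),
        ContMDiff (𝓡 4) 𝓘(ℝ, EuclideanSpace ℝ (Fin N)) ∞ ι → Function.Injective ι →
      ∀ (h : ℕ → ℂ → punctured p) (G : ℂ → punctured p) (ζ₀ : ℂ),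
        (∀ j, IsEntireJCurve (𝓡 4) J (h j)) →
        Continuous G →
        (∀ D : Set ℂ, IsCompact D →
          TendstoUniformlyOn (fun j ζ => ι (h j ζ).1) (fun ζ => ι (G ζ).1) atTop D) →
        ContMDiffAt 𝓘(ℝ, ℂ) (𝓡 4) ∞ G ζ₀ ∧
        (∀ η : ℂ, mfderiv 𝓘(ℝ, ℂ) (𝓡 4) G ζ₀ (Complex.I * η : ℂ) =
          J (G ζ₀) (mfderiv 𝓘(ℝ, ℂ) (𝓡 4) G ζ₀ (η : ℂ))) ∧
        ((∀ j, ‖fderiv ℝ (fun ζ : ℂ => ι (h j ζ).1) ζ₀‖ = 1) →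
          fderiv ℝ (fun ζ : ℂ => extChartAt (𝓡 4) (G ζ₀) (G ζ)) ζ₀ ≠ 0)) →
    JHolomorphicWeierstrassR4 →
    ∀ (S : HomotopySphere 4) (p : S.carrier)
      (J : ∀ x : punctured p, TangentSpace (𝓡 4) x →L[ℝ] TangentSpace (𝓡 4) x),
      (∀ (x : punctured p) (v : TangentSpace (𝓡 4) x), J x (J x v) = -v) →
      (∀ x₀ : punctured p, ContMDiffAt (𝓡 4) 𝓘(ℝ, EuclideanSpace ℝ (Fin 4) →L[ℝ] EuclideanSpace ℝ (Fin 4)) ∞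
        (inTangentCoordinates (𝓡 4) (𝓡 4) (id : punctured p → punctured p) id (fun x => J x) x₀) x₀) →
      ∀ (N : ℕ) (ι : S.carrier → EuclideanSpace ℝ (Fin N)),
        ContMDiff (𝓡 4) 𝓘(ℝ, EuclideanSpace ℝ (Fin N)) ∞ ι → Function.Injective ι →
        (∀ x : S.carrier, Function.Injective (mfderiv (𝓡 4) 𝓘(ℝ, EuclideanSpace ℝ (Fin N)) ι x)) →
      ∀ (u : ℕ → ℂ → punctured p) (K : Set (punctured p)), IsCompact K →
        (∀ n, IsEntireJCurve (𝓡 4) J (u n)) →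
        (∀ n (z : ℂ), ‖z‖ ≤ 2 → u n z ∈ K) →
        (∀ C : ℝ, ∃ n, ∃ z : ℂ, ‖z‖ ≤ 1 ∧ C < ‖fderiv ℝ (fun w : ℂ => ι (u n w).1) z‖) →
        CurveAway S p J := by
  intro hLocal hW S p J hJ2 hJs N ι hι hιinj _hιimm u K hK hu huK hblow
  -- the compact `K' = ι(K) ⊆ ℝᴺ`
  set K' : Set (EuclideanSpace ℝ (Fin N)) := (fun x : punctured p => ι x.1) '' K
  have hK' : IsCompact K' := hK.image (hι.continuous.comp continuous_subtype_val)
  -- Step 1: blow-up points `c k`, `‖c k‖ ≤ 1`, of members `u (n k)`, and the recentred flat maps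
  -- `f k ξ = ι (u (n k) (c k + ξ))`
  choose n c hc hcn using fun k : ℕ => hblow (k : ℝ)
  obtain ⟨f, hfdef⟩ : ∃ f : ℕ → ℂ → EuclideanSpace ℝ (Fin N),
      ∀ k ξ, f k ξ = ι (u (n k) (c k + ξ)).1 := ⟨_, fun _ _ => rfl⟩
  have hfeq : ∀ k, f k = fun ξ => ι (u (n k) (c k + ξ)).1 := fun k => funext (hfdef k)
  have hfsmooth : ∀ k, ContDiff ℝ ∞ (f k) := fun k => by
    have h1 : ContDiff ℝ ∞ (fun w : ℂ => ι (u (n k) w).1) :=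
      contDiff_embed_comp hι (hu (n k)).contMDiff
    rw [hfeq]
    exact h1.comp (contDiff_const.add contDiff_id)
  have hf1 : ∀ k, ContDiff ℝ 1 (f k) := fun k => (hfsmooth k).of_le (by simp)
  have hfK : ∀ k (ξ : ℂ), ‖ξ‖ ≤ 1 → f k ξ ∈ K' := fun k ξ hξ => by
    rw [hfdef]
    refine ⟨u (n k) (c k + ξ), huK (n k) _ ?_, rfl⟩
    calc ‖c k + ξ‖ ≤ ‖c k‖ + ‖ξ‖ := norm_add_le _ _
      _ ≤ 1 + 1 := add_le_add (hc k) hξ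
      _ = 2 := by norm_num
  have hfderiv0 : ∀ k, fderiv ℝ (f k) 0 = fderiv ℝ (fun w : ℂ => ι (u (n k) w).1) (c k) :=
    fun k => by
      rw [hfeq, fderiv_comp_add_left (f := fun w : ℂ => ι (u (n k) w).1) (c k), add_zero]
  have hfk : ∀ k : ℕ, (k : ℝ) < ‖fderiv ℝ (f k) 0‖ := fun k => by
    rw [hfderiv0]
    exact hcn k
  have hf0 : ∀ k, fderiv ℝ (f k) 0 ≠ 0 := fun k h0 => by
    have := hfk k
    rw [h0, norm_zero] at this
    exact absurd this (not_lt.2 (Nat.cast_nonneg k))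
  -- Step 2: flat Zalcman–Brody rescaling of each `f k`
  choose ξ₀ ρ M hρ _hξ₀ hM hgK hg0 hgd using
    fun k : ℕ => helper_flatZalcman K' (f k) (hf1 k) (hfK k) (hf0 k)
  -- the rescaled curves on the manifold: `hh k ζ = u (n k) (ρ k ζ + (c k + ξ₀ k))`
  obtain ⟨hh, hhdef⟩ : ∃ hh : ℕ → ℂ → punctured p,
      ∀ k, hh k = u (n k) ∘ fun ζ : ℂ => (ρ k : ℂ) * ζ + (c k + ξ₀ k) := ⟨_, fun _ => rfl⟩
  have hh_entire : ∀ k, IsEntireJCurve (𝓡 4) J (hh k) := fun k => by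
    rw [hhdef]
    exact (hu (n k)).comp_affine (Complex.ofReal_ne_zero.2 (hρ k).ne') (c k + ξ₀ k)
  have hfh : ∀ k (ζ : ℂ), f k (ξ₀ k + ρ k • ζ) = ι (hh k ζ).1 := fun k ζ => by
    rw [hfdef, hhdef, Function.comp_apply, Complex.real_smul,
      show c k + (ξ₀ k + (ρ k : ℂ) * ζ) = (ρ k : ℂ) * ζ + (c k + ξ₀ k) by ring]
  have hfun : ∀ k, (fun ζ : ℂ => f k (ξ₀ k + ρ k • ζ)) = fun ζ => ι (hh k ζ).1 :=
    fun k => funext (hfh k)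
  have hgK' : ∀ k (ζ : ℂ), ‖ζ‖ ≤ M k / 2 → ι (hh k ζ).1 ∈ K' := fun k ζ hζ => by
    rw [← hfh]
    exact hgK k ζ hζ
  have hg0' : ∀ k, ‖fderiv ℝ (fun ζ : ℂ => ι (hh k ζ).1) 0‖ = 1 := fun k => by
    rw [← hfun]
    exact hg0 k
  have hgd' : ∀ k (ζ : ℂ), ‖ζ‖ ≤ M k / 2 → ‖fderiv ℝ (fun ζ : ℂ => ι (hh k ζ).1) ζ‖ ≤ 2 :=
    fun k ζ hζ => by
      rw [← hfun]
      exact hgd k ζ hζ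
  have hgsmooth : ∀ k, ContDiff ℝ ∞ (fun ζ : ℂ => ι (hh k ζ).1) := fun k =>
    contDiff_embed_comp hι (hh_entire k).contMDiff
  -- the radii `M k / 2 ≥ k / 2` tend to infinity
  have hMk : ∀ k : ℕ, (k : ℝ) / 2 ≤ M k / 2 := fun k => by
    have := (hfk k).le.trans (hM k)
    linarith
  have hr : Tendsto (fun k => M k / 2) atTop atTop :=
    tendsto_atTop_mono hMk (tendsto_natCast_atTop_atTop.atTop_div_const two_pos)
  -- Step 3: Arzelà–Ascoli extraction in `ℝᴺ`
  obtain ⟨v, φ, hφ, hconv⟩ := helper_subseqLocUnif K' hK' (fun k ζ => ι (hh k ζ).1)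
    (fun k => M k / 2) hr (fun k => (hgsmooth k).differentiable (by simp)) hgK' hgd'
  -- Step 4: lift the limit `v` to `G : ℂ → Σ ∖ p` with values in `K`
  have hrφ : Tendsto (fun j => M (φ j) / 2) atTop atTop := hr.comp hφ.tendsto_atTop
  have hlim : ∀ ζ : ℂ, Tendsto (fun j => ι (hh (φ j) ζ).1) atTop (𝓝 (v ζ)) := fun ζ =>
    (hconv.tendstoLocallyUniformlyOn (s := univ)).tendsto_at (mem_univ ζ)
  have hvK : ∀ ζ : ℂ, ∃ x ∈ K, ι x.1 = v ζ := fun ζ => by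
    have hmem : v ζ ∈ K' := hK'.isClosed.mem_of_tendsto (hlim ζ)
      ((hrφ.eventually_ge_atTop ‖ζ‖).mono fun j hj => hgK' (φ j) ζ hj)
    obtain ⟨x, hx, hxv⟩ := hmem
    exact ⟨x, hx, hxv⟩
  choose G hGK hGv using hvK
  have hvcont : Continuous v :=
    hconv.continuous (Eventually.of_forall fun j => (hgsmooth (φ j)).continuous).frequently
  have hemb : Topology.IsEmbedding (fun x : punctured p => ι x.1) :=
    (hι.continuous.isClosedEmbedding hιinj).isEmbedding.comp Topology.IsEmbedding.subtypeVal
  have hGcont : Continuous G :=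
    hemb.continuous_iff.2 (hvcont.congr fun ζ => (hGv ζ).symm)
  have hconv' : TendstoLocallyUniformly (fun j ζ => ι (hh (φ j) ζ).1) (fun ζ => ι (G ζ).1)
      atTop :=
    hconv.congr_right fun ζ => (hGv ζ).symm
  have hunif : ∀ D : Set ℂ, IsCompact D →
      TendstoUniformlyOn (fun j ζ => ι (hh (φ j) ζ).1) (fun ζ => ι (G ζ).1) atTop D :=
    fun D hD => (tendstoLocallyUniformly_iff_forall_isCompact.1 hconv') D hD
  -- Step 5: the local lemma at every point: `G` is a non-constant entire `J`-curve
  have hL := fun ζ₀ : ℂ => hLocal hW S p J hJ2 hJs N ι hι hιinj (fun j => hh (φ j)) G ζ₀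
    (fun j => hh_entire (φ j)) hGcont hunif
  have hGsmooth : ContMDiff 𝓘(ℝ, ℂ) (𝓡 4) ∞ G := fun ζ₀ => (hL ζ₀).1
  have hGhol : IsJHolomorphic (𝓡 4) J G := fun ζ₀ η => (hL ζ₀).2.1 η
  have hne0 := (hL 0).2.2 fun j => hg0' (φ j)
  have hGne : ∃ z z' : ℂ, G z ≠ G z' := by
    by_contra hcon
    push Not at hcon
    have hfun0 : (fun ζ : ℂ => extChartAt (𝓡 4) (G 0) (G ζ)) =
        fun _ : ℂ => extChartAt (𝓡 4) (G 0) (G 0) := funext fun ζ => by rw [hcon ζ 0]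
    exact hne0 (by rw [hfun0]; exact fderiv_const_apply _)
  -- Step 6: the image of `G` lies in `K`, which misses a punctured chart ball at `p`
  obtain ⟨η, hη, hηK⟩ := exists_ball_disjoint_of_isCompact hK
  exact ⟨G, ⟨hGsmooth, hGne, hGhol⟩, η, hη, fun w hw => hηK (G w) hw (hGK w)⟩

end Summit.SmoothPoincare4.SmoothPoincare4.Theorems.WitnessCharge.PencilIncompleteness
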